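import Mathlib.LinearAlgebra.Matrix.GeneralLinearGroup.Defs
import Mathlib.LinearAlgebra.Matrix.SpecialLinearGroup
import Mathlib.LinearAlgebra.Projectivization.Independence
import Mathlib.FieldTheory.IsAlgClosed.AlgebraicClosure
import Mathlib.RingTheory.Etale.Field
import Mathlib.Data.Set.Card
import HarnessLib

/-!
# Bhargava's space of quintic rings `V = 4 ⊗ ∧² 5`

Topic `NumberTheory/NumberFields` (definition request `defn-BhargavaQuinticSpace`, wanted by the
route `Summit.Langlands.Langlands.Theses.E8QuinticResidue`).

The prehomogeneous vector space of *quadruples of quinary alternating 2-forms*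
`V(R) = R⁴ ⊗ ∧² R⁵`, realised as quadruples `A = (A₁, A₂, A₃, A₄)` of alternating `5 × 5`
matrices over a commutative ring `R` [Bhargava2008, §1 Thm 1 and §3], with

* `altMatrix n R` — the `R`-module of alternating matrices (`Aᵀ = -A`, zero diagonal), the
  matrix model of `∧² Rⁿ`;
* `BhargavaQuinticSpace R := Fin 4 → altMatrix (Fin 5) R` and the left action of
  `GL₄(R) × GL₅(R)`, `((g₄, g₅) • A)ᵢ = ∑ⱼ (g₄)ᵢⱼ • g₅ Aⱼ g₅ᵀ` (the group of Wright–Yukie's case (11),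
  [Yukie1993, §0.2 (11)]; Bhargava's `Γ = GL₄(ℤ) × SL₅(ℤ)` [Bhargava2008, Thm 1] acts through
  `SL₅ → GL₅`, an instance below);
* the `5 × 5` alternating matrix of linear forms `pencil A t = ∑ tᵢ Aᵢ`, the `4 × 4` Pfaffian `pf4`,
  the vector `subPfVec X = (Q₁, …, Q₅)` of signed `4 × 4` sub-Pfaffians of a `5 × 5` alternating
  matrix [Bhargava2008, (8) p. 63], the five quaternary quadratic forms
  `subPfaffian A i t = Qᵢ(∑ tⱼ Aⱼ)` [Bhargava2008, §3 p. 64], the polarisation `subPfBilin`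
  (`Q(X, X) = 2 Q(X)`, [Bhargava2008, p. 66]) and the fundamental `SL₅`-invariants
  `braceInvariant A i j k l m = {ijklm} = Q(Aᵢ, Aⱼ)ᵀ · Aₖ · Q(Aₗ, Aₘ)` [Bhargava2008, (18) p. 67];
* over a field `k` with algebraic closure `k̄`: the geometric zero locus
  `geomZeroLocus k A ⊆ ℙ³(k̄)` of `Q₁, …, Q₅`, *non-degeneracy* `IsNondegenerate k A` (the five
  sub-Pfaffians are linearly independent and meet in exactly five points of `ℙ³(k̄)` in general
  position — Bhargava's description of the open `GL₄ × SL₅`-orbit [Bhargava2008, §2 pp. 62–63,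
  §4 p. 64 first paragraph], equivalently `Disc(A) ≠ 0` [Bhargava2008, §4 p. 70]), the Galois
  action `galAct` on `ℙ³(k̄)`, and the quintic `k`-algebra `quinticAlgebraOf k A` of
  Galois-equivariant `k̄`-valued functions on the zero locus (the ring of global functions on the
  finite `k`-scheme `Z_A` cut out by the sub-Pfaffians — the geometric construction of
  Wright–Yukie, cf. [Bhargava2008, §2 pp. 59–63], [Yukie1993, §0.4]);
* the NAMED FACT `WrightYukie1992_orbit_bijective_etaleQuintic`: for `k` of characteristic `0`,
  `A ↦ quinticAlgebraOf k A` induces a bijection between `GL₄(k) × GL₅(k)`-orbits of non-degenerate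
  elements of `V(k)` and isomorphism classes of étale quintic `k`-algebras
  [WrightYukie1992; Yukie1993, §0.4 Thm (0.4.2); Bhargava2008, §2 and §4 p. 70].

## Design notes

* `∧² R⁵` is modelled by ALTERNATING matrices (skew-symmetric with zero diagonal); for `2` a
  non-zero-divisor (e.g. `ℤ`, fields of characteristic `≠ 2`) this is the same as skew-symmetric,
  which is Bhargava's wording ("5 × 5 skew-symmetric matrices").  Closure under `X ↦ P X Pᵀ` is
  proved via `X = N - Nᵀ` (`exists_eq_sub_transpose`).
* Signs: rows/columns are indexed by `Fin 5 = {0,…,4}`, so Bhargava's `Qᵢ = (-1)^{i+1} Pf(…)`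
  (`i = 1,…,5`) is `subPfVec X i = (-1)^i * pf4 (…)` here.
* Non-degeneracy is defined geometrically (over `k̄`), exactly by the three properties Bhargava
  proves for the open orbit and uses to characterise it; it is therefore only defined over fields.
  For `A ∈ V(ℤ)` use `IsNondegenerate ℚ (A.map (Int.castRingHom ℚ))`.
* Orbit statement: Wright–Yukie's group is `GL₄ × GL₅`.  Over `ℤ` (and `ℝ`) its orbits agree with
  those of Bhargava's `GL₄ × SL₅` (`-I₅` acts trivially), but over a general field `k` the
  `GL₄(k) × SL₅(k)`-orbits can be finer, so the fact is stated for `GL₄(k) × GL₅(k)` as printed.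

## Deliberately NOT here

* The degree-`40` discriminant polynomial `Disc(A) := Disc(R(A))` and the quintic ring `R(A)` over
  `ℤ` given by the multiplication table [Bhargava2008, (16), (17), (21), (22)]; the sextic resolvent
  ring and the integral parametrisation [Bhargava2008, Thm 1, Thm 17] — follow-up items.
* The identity `Q(g • v) = det(g) (g⁻¹)ᵀ Q(v)` [Bhargava2008, (8)] and the invariance of
  `geomZeroLocus` under `GL₅` (not needed to state the fact).

## References

* M. Bhargava, *Higher composition laws IV: The parametrization of quintic rings*, Ann. of Math.
  167 (2008), 53–94. [Bhargava2008]
* D. J. Wright, A. Yukie, *Prehomogeneous vector spaces and field extensions*, Invent. Math. 110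
  (1992), 283–314. [WrightYukie1992]
* A. Yukie, *Shintani Zeta Functions*, LMS Lecture Note Series 183, CUP (1993), §0.2 (case (11)) and
  §0.4, Theorem (0.4.2). [Yukie1993]
-/

noncomputable section

open Matrix
open scoped LinearAlgebra.Projectivization

namespace Literature.NumberTheory.NumberFields

universe u

/-! ### Alternating matrices -/

section AltMatrix

variable (n : Type*) (R : Type*) [CommRing R]

/-- The `R`-submodule of ALTERNATING `n × n` matrices: `Aᵀ = -A` and all diagonal entries vanish.
For `n = Fin m` this is the matrix model of `∧² Rᵐ` (`eᵢ ∧ eⱼ ↦ Eᵢⱼ - Eⱼᵢ`); when `2` is a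
non-zero-divisor in `R` it coincides with the skew-symmetric matrices. [folklore] -/
def altMatrix : Submodule R (Matrix n n R) where
  carrier := {A | Aᵀ = -A ∧ ∀ i, A i i = 0}
  add_mem' := by
    rintro A B ⟨hA, hA'⟩ ⟨hB, hB'⟩
    refine ⟨?_, fun i => ?_⟩
    · rw [transpose_add, hA, hB, neg_add]
    · simp [hA' i, hB' i]
  zero_mem' := ⟨by simp, fun _ => rfl⟩
  smul_mem' := by
    rintro c A ⟨hA, hA'⟩
    refine ⟨?_, fun i => ?_⟩
    · rw [transpose_smul, hA, smul_neg]
    · simp [hA' i]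

variable {n R}

/-- Membership in `altMatrix`: `Aᵀ = -A` and zero diagonal. [folklore] -/
theorem mem_altMatrix_iff (A : Matrix n n R) :
    A ∈ altMatrix n R ↔ Aᵀ = -A ∧ ∀ i, A i i = 0 :=
  Iff.rfl

/-- Entries of an alternating matrix are antisymmetric: `A j i = -A i j`. [folklore] -/
theorem apply_swap_of_mem_altMatrix {A : Matrix n n R} (hA : A ∈ altMatrix n R) (i j : n) :
    A j i = -A i j := by
  have h := congr_fun (congr_fun hA.1 i) j
  simpa [transpose_apply, neg_apply] using h

/-- `N - Nᵀ` is alternating for every square matrix `N`. [folklore] -/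
theorem sub_transpose_mem_altMatrix (N : Matrix n n R) : N - Nᵀ ∈ altMatrix n R := by
  refine ⟨?_, fun i => ?_⟩
  · rw [transpose_sub, transpose_transpose, neg_sub]
  · simp

/-- Every alternating matrix is `N - Nᵀ` for its strictly upper triangular part `N`
(so `altMatrix` is exactly the image of `N ↦ N - Nᵀ`). [folklore] -/
theorem exists_eq_sub_transpose [LinearOrder n] {A : Matrix n n R} (hA : A ∈ altMatrix n R) :
    ∃ N : Matrix n n R, A = N - Nᵀ := by
  refine ⟨Matrix.of fun i j => if i < j then A i j else 0, ?_⟩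
  ext i j
  rcases lt_trichotomy i j with h | h | h
  · simp [h, not_lt.mpr h.le]
  · subst h
    simp [hA.2 i]
  · simp [h, not_lt.mpr h.le, apply_swap_of_mem_altMatrix hA j i]

/-- Alternating matrices are stable under `X ↦ P X Pᵀ` (change of basis of a `2`-form).
[folklore] -/
theorem conj_mem_altMatrix [Fintype n] [LinearOrder n] (P : Matrix n n R) {A : Matrix n n R}
    (hA : A ∈ altMatrix n R) : P * A * Pᵀ ∈ altMatrix n R := by
  obtain ⟨N, rfl⟩ := exists_eq_sub_transpose hA
  have h : P * (N - Nᵀ) * Pᵀ = P * N * Pᵀ - (P * N * Pᵀ)ᵀ := by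
    simp only [Matrix.mul_sub, Matrix.sub_mul, transpose_mul, transpose_transpose, Matrix.mul_assoc]
  rw [h]
  exact sub_transpose_mem_altMatrix _

/-- The `R`-linear map `X ↦ P X Pᵀ` on alternating matrices (the action of `P ∈ GLₙ(R)` on
`∧² Rⁿ`). [folklore] -/
def conjAlt [Fintype n] [LinearOrder n] (P : Matrix n n R) : altMatrix n R →ₗ[R] altMatrix n R where
  toFun X := ⟨P * (X : Matrix n n R) * Pᵀ, conj_mem_altMatrix P X.2⟩
  map_add' X Y := by
    apply Subtype.ext
    simp [Matrix.mul_add, Matrix.add_mul]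
  map_smul' c X := by
    apply Subtype.ext
    simp

/-- Unfolding `conjAlt`: `conjAlt P X = P X Pᵀ`. [folklore] -/
@[simp]
theorem coe_conjAlt [Fintype n] [LinearOrder n] (P : Matrix n n R) (X : altMatrix n R) :
    (conjAlt P X : Matrix n n R) = P * (X : Matrix n n R) * Pᵀ :=
  rfl

/-- `conjAlt 1 = id`. [folklore] -/
theorem conjAlt_one [Fintype n] [LinearOrder n] (X : altMatrix n R) : conjAlt (1 : Matrix n n R) X = X :=
  Subtype.ext (by simp)

/-- `conjAlt (P * Q) = conjAlt P ∘ conjAlt Q`. [folklore] -/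
theorem conjAlt_mul [Fintype n] [LinearOrder n] (P Q : Matrix n n R) (X : altMatrix n R) :
    conjAlt (P * Q) X = conjAlt P (conjAlt Q X) :=
  Subtype.ext (by simp [transpose_mul, Matrix.mul_assoc])

end AltMatrix

/-! ### The space `V(R) = R⁴ ⊗ ∧² R⁵` and its group action -/

/-- **Bhargava's space of quintic rings** `V(R) = R⁴ ⊗ ∧² R⁵`: quadruples `(A₁, A₂, A₃, A₄)` of
alternating `5 × 5` matrices over `R` ("the space `ℤ⁴ ⊗ ∧²ℤ⁵` of quadruples of `5 × 5`
skew-symmetric matrices"). It is a free `R`-module of rank `40`.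
[cite: Bhargava2008, §1 Thm 1 and §3 p. 64] -/
abbrev BhargavaQuinticSpace (R : Type*) [CommRing R] : Type _ :=
  Fin 4 → altMatrix (Fin 5) R

namespace BhargavaQuinticSpace

variable {R : Type*} [CommRing R]

/-- The `GL₄`-part of the action: `g₄` replaces the quadruple `(Aⱼ)` by the quadruple of linear
combinations `(∑ⱼ (g₄)ᵢⱼ Aⱼ)ᵢ` (the standard representation of `GL₄` on `R⁴ ⊗ ∧²R⁵`).
[cite: Bhargava2008, §2 p. 62] -/
def glFourAct (g : Matrix (Fin 4) (Fin 4) R) (x : BhargavaQuinticSpace R) : BhargavaQuinticSpace R :=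
  fun i => ∑ j, g i j • x j

/-- The `GL₅`-part of the action: `g₅` acts on each alternating matrix by `Aⱼ ↦ g₅ Aⱼ g₅ᵀ`
(the representation `∧²` of the standard representation of `GL₅`). [cite: Bhargava2008, §2 p. 62] -/
def glFiveAct (h : Matrix (Fin 5) (Fin 5) R) (x : BhargavaQuinticSpace R) : BhargavaQuinticSpace R :=
  fun i => conjAlt h (x i)

/-- Unfolding `glFourAct`. [folklore] -/
theorem glFourAct_apply (g : Matrix (Fin 4) (Fin 4) R) (x : BhargavaQuinticSpace R) (i : Fin 4) :
    glFourAct g x i = ∑ j, g i j • x j :=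
  rfl

/-- Unfolding `glFiveAct`. [folklore] -/
theorem glFiveAct_apply (h : Matrix (Fin 5) (Fin 5) R) (x : BhargavaQuinticSpace R) (i : Fin 4) :
    glFiveAct h x i = conjAlt h (x i) :=
  rfl

/-- `glFourAct 1 = id`. [folklore] -/
theorem glFourAct_one (x : BhargavaQuinticSpace R) : glFourAct (1 : Matrix (Fin 4) (Fin 4) R) x = x := by
  funext i
  simp [glFourAct, Matrix.one_apply, ite_smul]

/-- `glFourAct (g g') = glFourAct g ∘ glFourAct g'`. [folklore] -/
theorem glFourAct_mul (g g' : Matrix (Fin 4) (Fin 4) R) (x : BhargavaQuinticSpace R) :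
    glFourAct (g * g') x = glFourAct g (glFourAct g' x) := by
  funext i
  simp only [glFourAct, Matrix.mul_apply, Finset.sum_smul, Finset.smul_sum, smul_smul]
  rw [Finset.sum_comm]

/-- `glFiveAct 1 = id`. [folklore] -/
theorem glFiveAct_one (x : BhargavaQuinticSpace R) : glFiveAct (1 : Matrix (Fin 5) (Fin 5) R) x = x := by
  funext i
  exact conjAlt_one (x i)

/-- `glFiveAct (h h') = glFiveAct h ∘ glFiveAct h'`. [folklore] -/
theorem glFiveAct_mul (h h' : Matrix (Fin 5) (Fin 5) R) (x : BhargavaQuinticSpace R) :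
    glFiveAct (h * h') x = glFiveAct h (glFiveAct h' x) := by
  funext i
  exact conjAlt_mul h h' (x i)

/-- The `GL₄`- and `GL₅`-parts of the action commute. [folklore] -/
theorem glFourAct_glFiveAct (g : Matrix (Fin 4) (Fin 4) R) (h : Matrix (Fin 5) (Fin 5) R)
    (x : BhargavaQuinticSpace R) :
    glFourAct g (glFiveAct h x) = glFiveAct h (glFourAct g x) := by
  funext i
  simp [glFourAct, glFiveAct, map_sum, map_smul]

/-- The left action of `G(R) = GL₄(R) × GL₅(R)` on `V(R) = R⁴ ⊗ ∧² R⁵`: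
`((g₄, g₅) • A)ᵢ = ∑ⱼ (g₄)ᵢⱼ • (g₅ Aⱼ g₅ᵀ)` — the tensor product of the standard representation of
`GL₄` with `∧²` of the standard representation of `GL₅` (Wright–Yukie's case (11),
`G = GL(4) × GL(5)`, `V = k⁴ ⊗ ∧² k⁵`).
[cite: Yukie1993, §0.2 (11); cf. Bhargava2008, §2 p. 62] -/
instance instMulActionGL : MulAction (GL (Fin 4) R × GL (Fin 5) R) (BhargavaQuinticSpace R) where
  smul g x := glFourAct (g.1 : Matrix (Fin 4) (Fin 4) R) (glFiveAct (g.2 : Matrix (Fin 5) (Fin 5) R) x)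
  one_smul x := by
    change glFourAct ((1 : GL (Fin 4) R) : Matrix (Fin 4) (Fin 4) R)
      (glFiveAct ((1 : GL (Fin 5) R) : Matrix (Fin 5) (Fin 5) R) x) = x
    rw [Units.val_one, Units.val_one, glFiveAct_one, glFourAct_one]
  mul_smul g g' x := by
    change glFourAct ((g.1 * g'.1 : GL (Fin 4) R) : Matrix (Fin 4) (Fin 4) R)
        (glFiveAct ((g.2 * g'.2 : GL (Fin 5) R) : Matrix (Fin 5) (Fin 5) R) x) =
      glFourAct (g.1 : Matrix (Fin 4) (Fin 4) R) (glFiveAct (g.2 : Matrix (Fin 5) (Fin 5) R)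
        (glFourAct (g'.1 : Matrix (Fin 4) (Fin 4) R) (glFiveAct (g'.2 : Matrix (Fin 5) (Fin 5) R) x)))
    rw [Units.val_mul, Units.val_mul, glFiveAct_mul, glFourAct_mul, glFourAct_glFiveAct (g'.1 : Matrix _ _ R)]

/-- Unfolding the action: `((g₄, g₅) • A)ᵢ = ∑ⱼ (g₄)ᵢⱼ • g₅ Aⱼ g₅ᵀ`. [folklore] -/
theorem smul_def (g : GL (Fin 4) R × GL (Fin 5) R) (x : BhargavaQuinticSpace R) :
    g • x = glFourAct (g.1 : Matrix (Fin 4) (Fin 4) R) (glFiveAct (g.2 : Matrix (Fin 5) (Fin 5) R) x) :=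
  rfl

/-- The action on matrix entries: `((g₄, g₅) • A)ᵢ = ∑ⱼ (g₄)ᵢⱼ • g₅ Aⱼ g₅ᵀ` as `5 × 5` matrices.
[folklore] -/
theorem coe_smul_apply (g : GL (Fin 4) R × GL (Fin 5) R) (x : BhargavaQuinticSpace R) (i : Fin 4) :
    ((g • x) i : Matrix (Fin 5) (Fin 5) R) =
      ∑ j, (g.1 : Matrix (Fin 4) (Fin 4) R) i j •
        ((g.2 : Matrix (Fin 5) (Fin 5) R) * (x j : Matrix (Fin 5) (Fin 5) R) * (g.2 : Matrix (Fin 5) (Fin 5) R)ᵀ) := by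
  simp [smul_def, glFourAct, glFiveAct]

/-- Bhargava's group `Γ(R) = GL₄(R) × SL₅(R)` acts through `SL₅ → GL₅`; over `ℤ` its orbits are
those of Theorem 1 of [Bhargava2008] (and agree with the `GL₄(ℤ) × GL₅(ℤ)`-orbits, `-I₅` acting
trivially). [cite: Bhargava2008, §1 Thm 1 and §3] -/
instance instMulActionSL :
    MulAction (GL (Fin 4) R × Matrix.SpecialLinearGroup (Fin 5) R) (BhargavaQuinticSpace R) :=
  MulAction.compHom (BhargavaQuinticSpace R)
    (MonoidHom.prodMap (MonoidHom.id (GL (Fin 4) R)) Matrix.SpecialLinearGroup.toGL)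

/-- The `GL₄ × SL₅`-action is the `GL₄ × GL₅`-action through `SL₅ → GL₅`. [folklore] -/
theorem sl_smul_def (g : GL (Fin 4) R × Matrix.SpecialLinearGroup (Fin 5) R)
    (x : BhargavaQuinticSpace R) :
    g • x = ((g.1, Matrix.SpecialLinearGroup.toGL g.2) : GL (Fin 4) R × GL (Fin 5) R) • x :=
  rfl

/-! ### Sub-Pfaffians and the fundamental invariants -/

/-- The `5 × 5` alternating matrix of linear forms attached to `A`, evaluated at `t ∈ R⁴`:
`A(t) = t₁ A₁ + t₂ A₂ + t₃ A₃ + t₄ A₄`. [cite: Bhargava2008, §3 p. 64] -/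
def pencil (x : BhargavaQuinticSpace R) (t : Fin 4 → R) : Matrix (Fin 5) (Fin 5) R :=
  ∑ i, t i • (x i : Matrix (Fin 5) (Fin 5) R)

/-- The Pfaffian of a `4 × 4` alternating matrix `M = (mᵢⱼ)` (indices `0,…,3`):
`Pf(M) = m₀₁ m₂₃ - m₀₂ m₁₃ + m₀₃ m₁₂`, the canonical square root of `det M`. [folklore] -/
def pf4 (M : Matrix (Fin 4) (Fin 4) R) : R :=
  M 0 1 * M 2 3 - M 0 2 * M 1 3 + M 0 3 * M 1 2

/-- The vector `Q(X) = (Q₁, …, Q₅)` of SIGNED `4 × 4` sub-Pfaffians of a `5 × 5` alternating matrix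
`X`: `Qᵢ` is `(-1)^i` times the Pfaffian of the principal submatrix of `X` obtained by deleting row
and column `i` (indices `i = 0,…,4`; Bhargava's `(-1)^{i+1}` for `i = 1,…,5`).
[cite: Bhargava2008, (8) p. 63] -/
def subPfVec (X : Matrix (Fin 5) (Fin 5) R) : Fin 5 → R :=
  fun i => (-1) ^ (i : ℕ) * pf4 (X.submatrix i.succAbove i.succAbove)

/-- The five quaternary quadratic forms `Q₁, …, Q₅` of `A ∈ V(R)`: the signed `4 × 4` sub-Pfaffians
of the single `5 × 5` alternating matrix `A₁t₁ + A₂t₂ + A₃t₃ + A₄t₄`, as functions of `t ∈ R⁴`.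
[cite: Bhargava2008, §3 p. 64] -/
def subPfaffian (x : BhargavaQuinticSpace R) (i : Fin 5) (t : Fin 4 → R) : R :=
  subPfVec (pencil x t) i

/-- The polarisation `Q(X, Y)` of the quadratic map `Q`: the symmetric bilinear map with
`Q(X, X) = 2 Q(X)`. [cite: Bhargava2008, §4 p. 66] -/
def subPfBilin (X Y : Matrix (Fin 5) (Fin 5) R) : Fin 5 → R :=
  subPfVec (X + Y) - subPfVec X - subPfVec Y

/-- Bhargava's fundamental `SL₅`-invariants of `A = (A₁, …, A₄)`:
`{ijklm} = Q(Aᵢ, Aⱼ)ᵀ · Aₖ · Q(Aₗ, Aₘ)` for `i, j, k, l, m ∈ {1, …, 4}` (degree `5` in the entries of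
`A`); the structure constants of the quintic ring `R(A)` are explicit `ℤ`-linear combinations of
them. [cite: Bhargava2008, (18) p. 67] -/
def braceInvariant (x : BhargavaQuinticSpace R) (i j k l m : Fin 4) : R :=
  subPfBilin (x i : Matrix (Fin 5) (Fin 5) R) (x j) ⬝ᵥ
    ((x k : Matrix (Fin 5) (Fin 5) R) *ᵥ subPfBilin (x l : Matrix (Fin 5) (Fin 5) R) (x m))

/-- `pf4` is homogeneous of degree `2`. [folklore] -/
theorem pf4_smul (c : R) (M : Matrix (Fin 4) (Fin 4) R) : pf4 (c • M) = c ^ 2 * pf4 M := by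
  simp only [pf4, Matrix.smul_apply, smul_eq_mul]
  ring

/-- `Q(cX) = c² Q(X)`. [folklore] -/
theorem subPfVec_smul (c : R) (X : Matrix (Fin 5) (Fin 5) R) : subPfVec (c • X) = c ^ 2 • subPfVec X := by
  funext i
  simp only [subPfVec, Pi.smul_apply, smul_eq_mul, submatrix_smul, pf4_smul]
  ring

/-- The pencil is linear in `t`: `A(c t) = c A(t)`. [folklore] -/
theorem pencil_smul (x : BhargavaQuinticSpace R) (c : R) (t : Fin 4 → R) :
    pencil x (c • t) = c • pencil x t := by
  simp only [pencil, Pi.smul_apply, smul_eq_mul, Finset.smul_sum, smul_smul]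

/-- The `Qᵢ` are quadratic forms: `Qᵢ(c t) = c² Qᵢ(t)`. [folklore] -/
theorem subPfaffian_smul (x : BhargavaQuinticSpace R) (i : Fin 5) (c : R) (t : Fin 4 → R) :
    subPfaffian x i (c • t) = c ^ 2 * subPfaffian x i t := by
  simp only [subPfaffian, pencil_smul, subPfVec_smul, Pi.smul_apply, smul_eq_mul]

/-! ### Base change -/

/-- Entrywise base change `V(R) → V(S)` along a ring homomorphism. [folklore] -/
def map {S : Type*} [CommRing S] (f : R →+* S) (x : BhargavaQuinticSpace R) : BhargavaQuinticSpace S :=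
  fun i => ⟨(x i : Matrix (Fin 5) (Fin 5) R).map f, by
    refine ⟨?_, fun a => ?_⟩
    · ext a b
      change f ((x i : Matrix (Fin 5) (Fin 5) R) b a) = -f ((x i : Matrix (Fin 5) (Fin 5) R) a b)
      rw [apply_swap_of_mem_altMatrix (x i).2 a b, map_neg]
    · simp [(x i).2.2 a]⟩

/-- Unfolding `map`: the `i`-th matrix of `map f A` is `(Aᵢ).map f`. [folklore] -/
@[simp]
theorem coe_map_apply {S : Type*} [CommRing S] (f : R →+* S) (x : BhargavaQuinticSpace R) (i : Fin 4) :
    (map f x i : Matrix (Fin 5) (Fin 5) S) = (x i : Matrix (Fin 5) (Fin 5) R).map f :=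
  rfl

/-! ### Over a field: the zero locus in `ℙ³(k̄)`, non-degeneracy, and the quintic algebra -/

section Field

variable (k : Type u) [Field k]

/-- Base change of `A ∈ V(k)` to the algebraic closure `k̄`. [folklore] -/
def baseChange (x : BhargavaQuinticSpace k) : BhargavaQuinticSpace (AlgebraicClosure k) :=
  map (algebraMap k (AlgebraicClosure k)) x

/-- The GEOMETRIC ZERO LOCUS `Z_A(k̄) ⊆ ℙ³(k̄)` of the five quadrics `Q₁ = ⋯ = Q₅ = 0` attached to
`A ∈ V(k)` (well defined since the `Qᵢ` are homogeneous, `mk_mem_geomZeroLocus_iff`). For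
non-degenerate `A` this is the set `X` of five points in general position of [Bhargava2008, §2].
[cite: Bhargava2008, §2 pp. 62–63] -/
def geomZeroLocus (x : BhargavaQuinticSpace k) :
    Set (ℙ (AlgebraicClosure k) (Fin 4 → AlgebraicClosure k)) :=
  {p | ∀ i, subPfaffian (baseChange k x) i p.rep = 0}

/-- Membership of `[v] ∈ ℙ³(k̄)` in the zero locus is vanishing of the `Qᵢ` at `v`. [folklore] -/
theorem mk_mem_geomZeroLocus_iff (x : BhargavaQuinticSpace k) (v : Fin 4 → AlgebraicClosure k)
    (hv : v ≠ 0) :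
    Projectivization.mk (AlgebraicClosure k) v hv ∈ geomZeroLocus k x ↔
      ∀ i, subPfaffian (baseChange k x) i v = 0 := by
  obtain ⟨a, ha⟩ := Projectivization.exists_smul_eq_mk_rep (AlgebraicClosure k) v hv
  simp only [geomZeroLocus, Set.mem_setOf_eq, ← ha, Units.smul_def, subPfaffian_smul]
  refine forall_congr' fun i => ?_
  rw [mul_eq_zero, or_iff_right]
  exact pow_ne_zero 2 a.ne_zero

/-- A set of points of `ℙ³ = ℙ(K⁴)` is in GENERAL POSITION if no four of its points lie on a plane,
i.e. any four distinct points of it are projectively independent. [cite: Bhargava2008, §2 p. 60] -/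
def InGeneralPosition {K : Type*} [Field K] (S : Set (ℙ K (Fin 4 → K))) : Prop :=
  ∀ f : Fin 4 → ℙ K (Fin 4 → K), Function.Injective f → (∀ i, f i ∈ S) →
    Projectivization.Independent f

/-- **Non-degeneracy.** `A ∈ V(k)` is NON-DEGENERATE if, over `k̄`, its five sub-Pfaffian quadratic
forms `Q₁, …, Q₅` are linearly independent (as functions on `k̄⁴` — `k̄` being infinite, this is
linear independence of the quadratic forms) and their common zero locus in `ℙ³(k̄)` consists of
exactly five points (`Set.ncard = 5`, so in particular finite) in general position.  These are the properties Bhargava establishes for the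
elements of the open `GL₄(ℂ) × SL₅(ℂ)`-orbit ("nondegenerate" elements, p. 63: the sub-Pfaffians span
the five-dimensional space of quadrics through five points in general position, whose common zeros
are only these points, p. 62) and which characterise it ("up to scaling there is only a single
`SL₅(ℂ)`-orbit of points `A ∈ V` whose five independent `4 × 4` sub-Pfaffians vanish on the five
points", p. 64); equivalently `Disc(A) ≠ 0` (p. 70), Wright–Yukie's `V_k^{ss}`.
[cite: Bhargava2008, §2 pp. 62–63 and §4 pp. 64, 70] -/
def IsNondegenerate (x : BhargavaQuinticSpace k) : Prop :=
  LinearIndependent (AlgebraicClosure k)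
      (fun i : Fin 5 => (subPfaffian (baseChange k x) i : (Fin 4 → AlgebraicClosure k) → AlgebraicClosure k)) ∧
    (geomZeroLocus k x).ncard = 5 ∧ InGeneralPosition (geomZeroLocus k x)

variable {k} in
/-- A non-degenerate element has a finite geometric zero locus (of cardinality `5`). [folklore] -/
theorem IsNondegenerate.finite_geomZeroLocus {x : BhargavaQuinticSpace k} (h : IsNondegenerate k x) :
    (geomZeroLocus k x).Finite :=
  Set.finite_of_ncard_ne_zero (by rw [h.2.1]; decide)

/-- The coordinatewise action of `σ ∈ Gal(k̄/k)` on `k̄⁴`, a `σ`-semilinear bijection. [folklore] -/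
def galSemilinear (σ : AlgebraicClosure k ≃ₐ[k] AlgebraicClosure k) :
    (Fin 4 → AlgebraicClosure k) →ₛₗ[(σ : AlgebraicClosure k →+* AlgebraicClosure k)]
      (Fin 4 → AlgebraicClosure k) where
  toFun v := fun i => σ (v i)
  map_add' v w := by
    funext i
    simp
  map_smul' c v := by
    funext i
    simp [smul_eq_mul]

/-- Unfolding `galSemilinear`. [folklore] -/
@[simp]
theorem galSemilinear_apply (σ : AlgebraicClosure k ≃ₐ[k] AlgebraicClosure k)
    (v : Fin 4 → AlgebraicClosure k) (i : Fin 4) : galSemilinear k σ v i = σ (v i) :=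
  rfl

/-- `galSemilinear σ` is injective. [folklore] -/
theorem galSemilinear_injective (σ : AlgebraicClosure k ≃ₐ[k] AlgebraicClosure k) :
    Function.Injective (galSemilinear k σ) := by
  intro v w h
  funext i
  exact σ.injective (congr_fun h i)

/-- The action of `σ ∈ Gal(k̄/k)` on `ℙ³(k̄)`, `[v₀ : ⋯ : v₃] ↦ [σ v₀ : ⋯ : σ v₃]`. [folklore] -/
def galAct (σ : AlgebraicClosure k ≃ₐ[k] AlgebraicClosure k) :
    ℙ (AlgebraicClosure k) (Fin 4 → AlgebraicClosure k) → ℙ (AlgebraicClosure k) (Fin 4 → AlgebraicClosure k) :=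
  Projectivization.map (galSemilinear k σ) (galSemilinear_injective k σ)

/-- `galAct σ [v] = [σ v]`. [folklore] -/
theorem galAct_mk (σ : AlgebraicClosure k ≃ₐ[k] AlgebraicClosure k) (v : Fin 4 → AlgebraicClosure k)
    (hv : v ≠ 0) :
    galAct k σ (Projectivization.mk _ v hv) =
      Projectivization.mk _ (galSemilinear k σ v)
        (map_zero (galSemilinear k σ) ▸ (galSemilinear_injective k σ).ne hv) :=
  rfl

/-- The Galois action is compatible with the quadrics `Qᵢ` of an element defined over `k`:
`Qᵢ(σ v) = σ (Qᵢ(v))`. [folklore] -/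
theorem subPfaffian_baseChange_galSemilinear (x : BhargavaQuinticSpace k)
    (σ : AlgebraicClosure k ≃ₐ[k] AlgebraicClosure k) (i : Fin 5) (v : Fin 4 → AlgebraicClosure k) :
    subPfaffian (baseChange k x) i (galSemilinear k σ v) = σ (subPfaffian (baseChange k x) i v) := by
  have hp : pencil (baseChange k x) (galSemilinear k σ v) = (pencil (baseChange k x) v).map σ := by
    ext a b
    simp [pencil, baseChange, Matrix.sum_apply, map_sum, map_mul, AlgEquiv.commutes]
  simp only [subPfaffian, hp, subPfVec, pf4, submatrix_apply, map_apply, map_add, map_sub, map_mul,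
    map_pow, map_neg, map_one]

/-- The Galois action on `ℙ³(k̄)` preserves the zero locus of an element of `V(k)`. [folklore] -/
theorem galAct_mem_geomZeroLocus (x : BhargavaQuinticSpace k)
    (σ : AlgebraicClosure k ≃ₐ[k] AlgebraicClosure k)
    {p : ℙ (AlgebraicClosure k) (Fin 4 → AlgebraicClosure k)} (hp : p ∈ geomZeroLocus k x) :
    galAct k σ p ∈ geomZeroLocus k x := by
  induction p using Projectivization.ind with
  | h v hv =>
    rw [galAct_mk, mk_mem_geomZeroLocus_iff]
    rw [mk_mem_geomZeroLocus_iff] at hp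
    intro i
    rw [subPfaffian_baseChange_galSemilinear, hp i, map_zero]

/-- **The quintic `k`-algebra `K(A)` of `A ∈ V(k)`**: the `k`-algebra of `Gal(k̄/k)`-EQUIVARIANT
functions `f : Z_A(k̄) → k̄` on the geometric zero locus of the sub-Pfaffians
(`f (σ p) = σ (f p)`), i.e. the ring of global functions `H⁰(Z_A, 𝒪)` of the finite `k`-scheme
`Z_A ⊆ ℙ³_k` cut out by `Q₁, …, Q₅`, described through its geometric points.  For non-degenerate
`A` over `k` of characteristic `0` this is the étale quintic `k`-algebra with
`Hom_k(K(A), k̄) = Z_A(k̄)` — for `A` attached to a quintic ring `R` it recovers `R ⊗ ℚ`, whose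
five homomorphisms to `ℂ` are indexed by the five points `x_R^{(1)}, …, x_R^{(5)}`
[Bhargava2008, §2 pp. 59–60 and §4 p. 70]; its Galois closure (the splitting field of a defining
quintic) is Wright–Yukie's field `k(x)`, whose construction "was geometric also" [Yukie1993, §0.4].
[cite: Bhargava2008, §2 pp. 59–63; Yukie1993, §0.4] -/
def quinticAlgebraOf (x : BhargavaQuinticSpace k) :
    Subalgebra k (geomZeroLocus k x → AlgebraicClosure k) where
  carrier := {f | ∀ (σ : AlgebraicClosure k ≃ₐ[k] AlgebraicClosure k) (p q : geomZeroLocus k x),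
    galAct k σ p = q → f q = σ (f p)}
  mul_mem' := by
    intro f g hf hg σ p q h
    simp only [Pi.mul_apply, map_mul, hf σ p q h, hg σ p q h]
  one_mem' := by
    intro σ p q _
    simp
  add_mem' := by
    intro f g hf hg σ p q h
    simp only [Pi.add_apply, map_add, hf σ p q h, hg σ p q h]
  zero_mem' := by
    intro σ p q _
    simp
  algebraMap_mem' := by
    intro c σ p q _
    simp [Algebra.algebraMap_eq_smul_one]

/-- Membership in `K(A)`: Galois-equivariance `f (σ p) = σ (f p)`. [folklore] -/
theorem mem_quinticAlgebraOf_iff (x : BhargavaQuinticSpace k) (f : geomZeroLocus k x → AlgebraicClosure k) :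
    f ∈ quinticAlgebraOf k x ↔
      ∀ (σ : AlgebraicClosure k ≃ₐ[k] AlgebraicClosure k) (p q : geomZeroLocus k x),
        galAct k σ p = q → f q = σ (f p) :=
  Iff.rfl

end Field

/-! ### The orbit parametrisation over a field (Wright–Yukie; Bhargava) -/

/-- **Wright–Yukie / Bhargava: non-degenerate orbits ↔ étale quintic algebras.**  Let `k` be a field
of characteristic `0`, `G = GL₄ × GL₅` acting on `V = k⁴ ⊗ ∧² k⁵`.  Then `A ↦ K(A)`
(`quinticAlgebraOf`) induces a canonical bijection between the `G(k)`-orbits of non-degenerate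
elements of `V(k)` and the isomorphism classes of étale `k`-algebras of degree `5`:
(a) `K(A)` is an étale quintic `k`-algebra for every non-degenerate `A`;
(b) two non-degenerate `A, A'` lie in the same `G(k)`-orbit iff `K(A) ≅ K(A')` as `k`-algebras;
(c) every étale quintic `k`-algebra is `≅ K(A)` for some non-degenerate `A ∈ V(k)`.
(Wright–Yukie 1992, case (11) `G = GL(4) × GL(5)`, `V = k⁴ ⊗ ∧²k⁵`, `k` of characteristic `0`:
`G_k \ V_k^{ss}` corresponds bijectively with `H¹(k̄/k, G_w)`, there is `w ∈ V_k^{ss}` with `G_w⁰` a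
product of `GL(n)`'s and `G_w/G_w⁰ ≅ 𝔖₅` with trivial Galois action, `G_k x = G_k y` iff the
homomorphisms `p_x, p_y : Gal(k̄/k) → 𝔖₅` are conjugate, and the `k(x)` are exactly the splitting
fields of degree-`5` equations without multiple roots, all of which arise; restated in
[Yukie1993, §0.4, Prop (0.4.1), Thm (0.4.2) and the paragraph between them].  Bhargava: the stabiliser in
`GL₄(ℂ) × SL₅(ℂ)` of a non-degenerate point is `𝔖₅ = Perm(X)` [Bhargava2008, §2 p. 63], and
non-degenerate `A` correspond to étale quintic algebras `R(A) ⊗ k` [Bhargava2008, §3 p. 64, §4 p. 70].)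
[cite: Yukie1993, §0.4 Thm (0.4.2); WrightYukie1992; Bhargava2008, §2 p. 63 and §4 p. 70] -/
def WrightYukie1992_orbit_bijective_etaleQuintic : Prop :=
  ∀ (k : Type u) [Field k] [CharZero k],
    (∀ x : BhargavaQuinticSpace k, IsNondegenerate k x →
        Algebra.Etale k (quinticAlgebraOf k x) ∧ Module.finrank k (quinticAlgebraOf k x) = 5) ∧
    (∀ x y : BhargavaQuinticSpace k, IsNondegenerate k x → IsNondegenerate k y →
        ((∃ g : GL (Fin 4) k × GL (Fin 5) k, g • x = y) ↔
          Nonempty (quinticAlgebraOf k x ≃ₐ[k] quinticAlgebraOf k y))) ∧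
    (∀ (L : Type u) [CommRing L] [Algebra k L], Algebra.Etale k L → Module.finrank k L = 5 →
        ∃ x : BhargavaQuinticSpace k, IsNondegenerate k x ∧ Nonempty (quinticAlgebraOf k x ≃ₐ[k] L))

end BhargavaQuinticSpace

end Literature.NumberTheory.NumberFields
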